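import Summits.AtomisticToContinuum.Crystallization.Theorems.ChartedPlanarOrderLayerChainLiouvilleTail

/-!
# Layer-chain Liouville with windows — part 2/3: bounded relative offsets force equal transmitted stress (finite coupling range `R`)
(decomp-a2c lens-3 g22 `LayerChainTail.lean` v3 sha256 89685986…, lines 166–422, split into three modules at the gate's 400-line limit;
content byte-identical; namespace kept `…ChartedPlanarOrderLayerChainLiouvilleTail` throughout as the author specified).  Pure Mathlib on top of
part 1; def-free; sorry-free.
-/

noncomputable section

open scoped RealInnerProductSpace

namespace Summit.AtomisticToContinuum.Crystallization.Theorems.ChartedPlanarOrderLayerChainLiouvilleTail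

variable {E : Type*} [NormedAddCommGroup E] [InnerProductSpace ℝ E]

/-! ## Bounded relative offsets force EQUAL transmitted stress — the «same σ» step of PS (finite coupling range `R`, ℓ¹ form)
Two door layered states with the same in-plane lattice whose offset profiles stay at BOUNDED distance transmit the same stress:
block-summed strong monotonicity bounds `Σ_{m ∈ [a,b]} ‖d m‖²` uniformly in the block (`d = g − g'` the increment difference, whose block
sums telescope to bounded offset differences), so `d m → 0` as `|m| → ∞`, and the constant residual `σ − σ' = Φ m g − Φ m g'` is then
arbitrarily small.  With `layerChainTail_unique` this gives the full abstract PS: bounded offset difference ⇒ translation. -/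

omit [InnerProductSpace ℝ E] in
/-- telescoping over an integer block. -/
theorem sum_Icc_sub_telescope (u : ℤ → E) (a : ℤ) (n : ℕ) :
    ∑ m ∈ Finset.Icc a (a + n), (u m - u (m - 1)) = u (a + n) - u (a - 1) := by
  induction n with
  | zero => simp
  | succ n ih =>
    have h1 : (a : ℤ) + ((n + 1 : ℕ) : ℤ) = a + n + 1 := by push_cast; ring
    rw [h1, ← Finset.insert_Icc_right_eq_Icc_add_one (by omega), Finset.sum_insert (by simp), ih]
    rw [add_sub_cancel_right]; abel

omit [InnerProductSpace ℝ E] in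
/-- bounded offset difference ⇒ bounded block sums of the increment difference. -/
theorem norm_sum_Icc_increments_le {w w' : ℤ → E} {D : ℝ} (hD : ∀ m, ‖w m - w' m‖ ≤ D) (a b : ℤ) :
    ‖∑ m ∈ Finset.Icc a b, ((w m - w (m - 1)) - (w' m - w' (m - 1)))‖ ≤ 2 * D := by
  have hD0 : 0 ≤ D := (norm_nonneg _).trans (hD 0)
  rcases le_or_gt a b with hab | hab
  · obtain ⟨n, hn⟩ : ∃ n : ℕ, b = a + n := ⟨(b - a).toNat, by omega⟩
    have hre : ∀ m : ℤ, (w m - w (m - 1)) - (w' m - w' (m - 1)) = (w m - w' m) - (w (m - 1) - w' (m - 1)) := fun m => by abel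
    simp_rw [hre]
    rw [hn, sum_Icc_sub_telescope (fun m => w m - w' m) a n]
    calc ‖(w (a + n) - w' (a + n)) - (w (a - 1) - w' (a - 1))‖ ≤ ‖w (a + n) - w' (a + n)‖ + ‖w (a - 1) - w' (a - 1)‖ := norm_sub_le _ _
      _ ≤ D + D := add_le_add (hD _) (hD _)
      _ = 2 * D := by ring
  · rw [Finset.Icc_eq_empty (not_le.2 hab), Finset.sum_empty, norm_zero]; linarith

/-- shifting a block by `|j| ≤ R` changes a sum of nonnegative, `B`-bounded terms by at most `2R·B`. -/
theorem sum_Icc_shift_le (f : ℤ → ℝ) (hf : ∀ m, 0 ≤ f m) {B : ℝ} (hB : ∀ m, f m ≤ B) (a b : ℤ) (R : ℕ) {j : ℤ}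
    (hj : j ∈ Finset.Icc (-(R : ℤ)) R) : ∑ m ∈ Finset.Icc a b, f (m + j) ≤ ∑ m ∈ Finset.Icc a b, f m + 2 * R * B := by
  rw [Finset.mem_Icc] at hj
  have hB0 : 0 ≤ B := (hf 0).trans (hB 0)
  have h1 : ∑ m ∈ Finset.Icc a b, f (m + j) = ∑ m ∈ Finset.Icc (a + j) (b + j), f m := by
    rw [← Finset.map_add_right_Icc, Finset.sum_map]; rfl
  have hsub1 : Finset.Icc (a + j) (b + j) ⊆ Finset.Icc (a - R) (b + R) := Finset.Icc_subset_Icc (by omega) (by omega)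
  have hsub2 : Finset.Icc a b ⊆ Finset.Icc (a - R) (b + R) := Finset.Icc_subset_Icc (by omega) (by omega)
  have h2 : ∑ m ∈ Finset.Icc (a + j) (b + j), f m ≤ ∑ m ∈ Finset.Icc (a - R) (b + R), f m :=
    Finset.sum_le_sum_of_subset_of_nonneg hsub1 (fun i _ _ => hf i)
  have h3 := Finset.sum_sdiff (f := f) hsub2
  have hcard : ((Finset.Icc (a - R) (b + R)) \ Finset.Icc a b).card ≤ 2 * R := by
    have hsub : (Finset.Icc (a - R) (b + R)) \ Finset.Icc a b ⊆ Finset.Icc (a - R) (a - 1) ∪ Finset.Icc (b + 1) (b + R) := by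
      intro m hm
      simp only [Finset.mem_sdiff, Finset.mem_Icc, Finset.mem_union] at hm ⊢
      omega
    refine (Finset.card_le_card hsub).trans ((Finset.card_union_le _ _).trans ?_)
    rw [Int.card_Icc, Int.card_Icc]
    omega
  have h4 : ∑ m ∈ (Finset.Icc (a - R) (b + R)) \ Finset.Icc a b, f m ≤ 2 * R * B := by
    refine (Finset.sum_le_card_nsmul _ _ B (fun m _ => hB m)).trans ?_
    rw [nsmul_eq_mul]
    have : (((Finset.Icc (a - ↑R) (b + ↑R)) \ Finset.Icc a b).card : ℝ) ≤ 2 * R := by exact_mod_cast hcard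
    nlinarith
  linarith

section Slaving

variable (Φ : ℤ → (ℤ → E) → E) (W : ℤ → Set E) (R : ℕ) (κ : ℤ → ℝ)

/-- pointwise energy inequality: `λ‖d m‖² ≤ ⟨σ − σ', d m⟩ + ‖d m‖·Σ_{j ≠ 0} κ j ‖d (m+j)‖`. -/
theorem slaving_pointwise {lam : ℝ}
    (hmono : ∀ m : ℤ, ∀ h : ℤ → E, (∀ k, h k ∈ W k) → ∀ b' ∈ W m,
      lam * ‖h m - b'‖ ^ 2 ≤ ⟪Φ m h - Φ m (Function.update h m b'), h m - b'⟫)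
    (hlip1 : ∀ m : ℤ, ∀ h h' : ℤ → E, (∀ k, h k ∈ W k) → (∀ k, h' k ∈ W k) →
      ‖Φ m h - Φ m h'‖ ≤ ∑ j ∈ Finset.Icc (-(R : ℤ)) R, κ j * ‖h (m + j) - h' (m + j)‖)
    (g g' : ℤ → E) (hg : ∀ k, g k ∈ W k) (hg' : ∀ k, g' k ∈ W k) {σ σ' : E} (hσ : ∀ m, Φ m g = σ) (hσ' : ∀ m, Φ m g' = σ')
    (m : ℤ) :
    lam * ‖g m - g' m‖ ^ 2 ≤ ⟪σ - σ', g m - g' m⟫ +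
      ‖g m - g' m‖ * ∑ j ∈ (Finset.Icc (-(R : ℤ)) R).erase 0, κ j * ‖g (m + j) - g' (m + j)‖ := by
  obtain ⟨h', hh'⟩ : ∃ h' : ℤ → E, h' = Function.update g m (g' m) := ⟨_, rfl⟩
  have hh'm : h' m = g' m := by rw [hh', Function.update_self]
  have hh'k : ∀ k, k ≠ m → h' k = g k := fun k hk => by rw [hh', Function.update_of_ne hk]
  have hh'W : ∀ k, h' k ∈ W k := fun k => by
    by_cases hk : k = m
    · rw [hk, hh'm]; exact hg' m
    · rw [hh'k k hk]; exact hg k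
  have h1 : lam * ‖g m - g' m‖ ^ 2 ≤ ⟪Φ m g - Φ m h', g m - g' m⟫ := by
    rw [hh']; exact hmono m g hg (g' m) (hg' m)
  have hΦ : Φ m g - Φ m h' = (σ - σ') + (Φ m g' - Φ m h') := by rw [← hσ m, ← hσ' m]; abel
  have hb : ‖Φ m g' - Φ m h'‖ ≤ ∑ j ∈ (Finset.Icc (-(R : ℤ)) R).erase 0, κ j * ‖g (m + j) - g' (m + j)‖ := by
    have h2 := hlip1 m g' h' hg' hh'W
    rw [← Finset.sum_erase (Finset.Icc (-(R : ℤ)) R) (a := 0) (by rw [add_zero, hh'm, sub_self, norm_zero, mul_zero])] at h2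
    refine h2.trans (le_of_eq (Finset.sum_congr rfl (fun j hj => ?_)))
    have hj0 : j ≠ 0 := (Finset.mem_erase.1 hj).1
    rw [hh'k (m + j) (by omega), norm_sub_rev]
  have h3 : ⟪Φ m g - Φ m h', g m - g' m⟫ ≤ ⟪σ - σ', g m - g' m⟫ + ‖g m - g' m‖ *
      ∑ j ∈ (Finset.Icc (-(R : ℤ)) R).erase 0, κ j * ‖g (m + j) - g' (m + j)‖ := by
    rw [hΦ, inner_add_left]
    have h4 := real_inner_le_norm (Φ m g' - Φ m h') (g m - g' m)
    nlinarith [norm_nonneg (g m - g' m)]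
  exact h1.trans h3

/-- **block energy bound**: `(λ − K)·Σ_{m ∈ [a,b]} ‖d m‖² ≤ 2D‖σ − σ'‖ + 4 K R D²`, uniformly in the block, where `K = Σ_{j≠0} κ j` and
`2D` bounds every block sum `‖Σ_{[a,b]} d‖` (bounded relative offsets). -/
theorem slaving_block {lam : ℝ} (hκ : ∀ j, 0 ≤ κ j)
    (hmono : ∀ m : ℤ, ∀ h : ℤ → E, (∀ k, h k ∈ W k) → ∀ b' ∈ W m,
      lam * ‖h m - b'‖ ^ 2 ≤ ⟪Φ m h - Φ m (Function.update h m b'), h m - b'⟫)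
    (hlip1 : ∀ m : ℤ, ∀ h h' : ℤ → E, (∀ k, h k ∈ W k) → (∀ k, h' k ∈ W k) →
      ‖Φ m h - Φ m h'‖ ≤ ∑ j ∈ Finset.Icc (-(R : ℤ)) R, κ j * ‖h (m + j) - h' (m + j)‖)
    (g g' : ℤ → E) (hg : ∀ k, g k ∈ W k) (hg' : ∀ k, g' k ∈ W k) {σ σ' : E} (hσ : ∀ m, Φ m g = σ) (hσ' : ∀ m, Φ m g' = σ')
    {D₂ : ℝ} (hsum : ∀ a b : ℤ, ‖∑ m ∈ Finset.Icc a b, (g m - g' m)‖ ≤ D₂) (a b : ℤ) :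
    (lam - ∑ j ∈ (Finset.Icc (-(R : ℤ)) R).erase 0, κ j) * ∑ m ∈ Finset.Icc a b, ‖g m - g' m‖ ^ 2 ≤
      ‖σ - σ'‖ * D₂ + (∑ j ∈ (Finset.Icc (-(R : ℤ)) R).erase 0, κ j) * R * D₂ ^ 2 := by
  -- abbreviations
  obtain ⟨K, hK⟩ : ∃ K, K = ∑ j ∈ (Finset.Icc (-(R : ℤ)) R).erase 0, κ j := ⟨_, rfl⟩
  obtain ⟨T, hT⟩ : ∃ T, T = ∑ m ∈ Finset.Icc a b, ‖g m - g' m‖ ^ 2 := ⟨_, rfl⟩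
  rw [← hK, ← hT]
  have hK0 : 0 ≤ K := by rw [hK]; exact Finset.sum_nonneg (fun j _ => hκ j)
  have hD0 : 0 ≤ D₂ := (norm_nonneg _).trans (hsum 0 0)
  -- every single increment difference is bounded by D₂ (block of length one)
  have hd : ∀ m, ‖g m - g' m‖ ≤ D₂ := fun m => by
    have := hsum m m; rwa [Finset.Icc_self, Finset.sum_singleton] at this
  -- sum the pointwise inequality over the block
  have hP := slaving_pointwise Φ W R κ hmono hlip1 g g' hg hg' hσ hσ'
  have hS1 : lam * T ≤ ∑ m ∈ Finset.Icc a b, ⟪σ - σ', g m - g' m⟫ +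
      ∑ m ∈ Finset.Icc a b, ‖g m - g' m‖ * ∑ j ∈ (Finset.Icc (-(R : ℤ)) R).erase 0, κ j * ‖g (m + j) - g' (m + j)‖ := by
    rw [hT, Finset.mul_sum, ← Finset.sum_add_distrib]
    exact Finset.sum_le_sum (fun m _ => hP m)
  -- the stress term telescopes
  have hS2 : ∑ m ∈ Finset.Icc a b, ⟪σ - σ', g m - g' m⟫ ≤ ‖σ - σ'‖ * D₂ := by
    rw [← inner_sum]
    exact (real_inner_le_norm _ _).trans (mul_le_mul_of_nonneg_left (hsum a b) (norm_nonneg _))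
  -- the cross term: Young + shift
  have hS3 : ∑ m ∈ Finset.Icc a b, ‖g m - g' m‖ * ∑ j ∈ (Finset.Icc (-(R : ℤ)) R).erase 0, κ j * ‖g (m + j) - g' (m + j)‖
      ≤ K * T + K * R * D₂ ^ 2 := by
    have hY : ∀ m, ‖g m - g' m‖ * ∑ j ∈ (Finset.Icc (-(R : ℤ)) R).erase 0, κ j * ‖g (m + j) - g' (m + j)‖ ≤
        (K / 2) * ‖g m - g' m‖ ^ 2 + (1 / 2) * ∑ j ∈ (Finset.Icc (-(R : ℤ)) R).erase 0, κ j * ‖g (m + j) - g' (m + j)‖ ^ 2 := by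
      intro m
      rw [Finset.mul_sum, hK, Finset.sum_div, Finset.sum_mul, Finset.mul_sum, ← Finset.sum_add_distrib]
      refine Finset.sum_le_sum (fun j _ => ?_)
      have hy := two_mul_le_add_sq ‖g m - g' m‖ ‖g (m + j) - g' (m + j)‖
      have := hκ j
      nlinarith
    have hY' := Finset.sum_le_sum (fun m (_ : m ∈ Finset.Icc a b) => hY m)
    rw [Finset.sum_add_distrib, ← Finset.mul_sum, ← hT, ← Finset.mul_sum, Finset.sum_comm] at hY'
    -- the shifted sums
    have hsh : ∑ j ∈ (Finset.Icc (-(R : ℤ)) R).erase 0, ∑ m ∈ Finset.Icc a b, κ j * ‖g (m + j) - g' (m + j)‖ ^ 2 ≤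
        K * (T + 2 * R * D₂ ^ 2) := by
      rw [hK, Finset.sum_mul]
      refine Finset.sum_le_sum (fun j hj => ?_)
      rw [← Finset.mul_sum]
      refine mul_le_mul_of_nonneg_left ?_ (hκ j)
      rw [hT]
      exact sum_Icc_shift_le (fun m => ‖g m - g' m‖ ^ 2) (fun m => sq_nonneg _) (fun m => by
        have := hd m; have := norm_nonneg (g m - g' m); nlinarith) a b R (Finset.mem_of_mem_erase hj)
    nlinarith
  nlinarith

/-- from a uniform block bound on `Σ d²`: the terms are eventually (in `|m|`) below any `η > 0`. -/
theorem eventually_small_of_block_bound (d : ℤ → ℝ) {C : ℝ}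
    (hC : ∀ a b : ℤ, ∑ m ∈ Finset.Icc a b, d m ^ 2 ≤ C) {η : ℝ} (hη : 0 < η) :
    ∃ N : ℕ, ∀ m : ℤ, (N : ℤ) < |m| → d m < η := by
  have hfin : {m : ℤ | η ≤ d m}.Finite := by
    by_contra hinf
    obtain ⟨n, hn⟩ : ∃ n : ℕ, C < n * η ^ 2 := by
      obtain ⟨n, hn⟩ := exists_nat_gt (C / η ^ 2)
      exact ⟨n, by rwa [div_lt_iff₀ (pow_pos hη 2)] at hn⟩
    obtain ⟨t, hts, htc⟩ := Set.Infinite.exists_subset_card_eq hinf n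
    have hC0 : 0 ≤ C := (Finset.sum_nonneg (fun m _ => sq_nonneg (d m))).trans (hC 0 0)
    have hn0 : 0 < n := by
      rcases Nat.eq_zero_or_pos n with h0 | h0
      · subst h0; simp at hn; linarith
      · exact h0
    have htne : t.Nonempty := Finset.card_pos.1 (by omega)
    have hsub : t ⊆ Finset.Icc (t.min' htne) (t.max' htne) := fun m hm =>
      Finset.mem_Icc.2 ⟨Finset.min'_le t m hm, Finset.le_max' t m hm⟩
    have h1 : (n : ℝ) * η ^ 2 ≤ ∑ m ∈ t, d m ^ 2 := by
      have h2 := Finset.card_nsmul_le_sum t (fun m => d m ^ 2) (η ^ 2) (fun m hm => by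
        have hm' : η ≤ d m := hts (Finset.mem_coe.2 hm)
        exact pow_le_pow_left₀ hη.le hm' 2)
      rwa [htc, nsmul_eq_mul] at h2
    have h2 : ∑ m ∈ t, d m ^ 2 ≤ C :=
      (Finset.sum_le_sum_of_subset_of_nonneg hsub (fun m _ _ => sq_nonneg _)).trans (hC _ _)
    linarith
  obtain ⟨N, hN⟩ : ∃ N : ℕ, ∀ m ∈ hfin.toFinset, m.natAbs ≤ N :=
    ⟨hfin.toFinset.sup Int.natAbs, fun m hm => Finset.le_sup (f := Int.natAbs) hm⟩
  refine ⟨N, fun m hm => ?_⟩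
  by_contra hlt
  have hmem : m ∈ hfin.toFinset := hfin.mem_toFinset.2 (not_lt.1 hlt)
  have h1 : (m.natAbs : ℤ) ≤ N := by exact_mod_cast hN m hmem
  rw [Int.natCast_natAbs] at h1
  exact absurd hm (not_lt.2 h1)

/-- **bounded relative offsets ⇒ EQUAL transmitted stress.** -/
theorem slaving_stress_eq {lam : ℝ} (hκ : ∀ j, 0 ≤ κ j) (hdom : ∑ j ∈ (Finset.Icc (-(R : ℤ)) R).erase 0, κ j < lam)
    (hmono : ∀ m : ℤ, ∀ h : ℤ → E, (∀ k, h k ∈ W k) → ∀ b' ∈ W m,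
      lam * ‖h m - b'‖ ^ 2 ≤ ⟪Φ m h - Φ m (Function.update h m b'), h m - b'⟫)
    (hlip1 : ∀ m : ℤ, ∀ h h' : ℤ → E, (∀ k, h k ∈ W k) → (∀ k, h' k ∈ W k) →
      ‖Φ m h - Φ m h'‖ ≤ ∑ j ∈ Finset.Icc (-(R : ℤ)) R, κ j * ‖h (m + j) - h' (m + j)‖)
    (g g' : ℤ → E) (hg : ∀ k, g k ∈ W k) (hg' : ∀ k, g' k ∈ W k) {σ σ' : E} (hσ : ∀ m, Φ m g = σ) (hσ' : ∀ m, Φ m g' = σ')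
    {D₂ : ℝ} (hsum : ∀ a b : ℤ, ‖∑ m ∈ Finset.Icc a b, (g m - g' m)‖ ≤ D₂) : σ = σ' := by
  obtain ⟨K, hK⟩ : ∃ K, K = ∑ j ∈ (Finset.Icc (-(R : ℤ)) R).erase 0, κ j := ⟨_, rfl⟩
  obtain ⟨Kall, hKall⟩ : ∃ Kall, Kall = ∑ j ∈ Finset.Icc (-(R : ℤ)) R, κ j := ⟨_, rfl⟩
  have hKall0 : 0 ≤ Kall := by rw [hKall]; exact Finset.sum_nonneg (fun j _ => hκ j)
  rw [← hK] at hdom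
  have hgap : 0 < lam - K := by linarith
  have hblock := slaving_block Φ W R κ hκ hmono hlip1 g g' hg hg' hσ hσ' hsum
  simp only [← hK] at hblock
  have hC : ∀ a b : ℤ, ∑ m ∈ Finset.Icc a b, ‖g m - g' m‖ ^ 2 ≤ (‖σ - σ'‖ * D₂ + K * R * D₂ ^ 2) / (lam - K) := fun a b => by
    rw [le_div_iff₀ hgap, mul_comm]; exact hblock a b
  by_contra hne
  have hpos : 0 < ‖σ - σ'‖ := norm_pos_iff.2 (sub_ne_zero.2 hne)
  obtain ⟨η, hη⟩ : ∃ η : ℝ, η = ‖σ - σ'‖ / (2 * (Kall + 1)) := ⟨_, rfl⟩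
  have hη0 : 0 < η := by rw [hη]; positivity
  obtain ⟨N, hN⟩ := eventually_small_of_block_bound (fun m => ‖g m - g' m‖) hC hη0
  obtain ⟨m₀, hm₀⟩ : ∃ m₀ : ℤ, m₀ = (N : ℤ) + R + 1 := ⟨_, rfl⟩
  have hsmall : ∀ j ∈ Finset.Icc (-(R : ℤ)) R, ‖g (m₀ + j) - g' (m₀ + j)‖ < η := fun j hj => by
    rw [Finset.mem_Icc] at hj
    exact hN _ (by rw [abs_of_nonneg (by omega)]; omega)
  have h1 : ‖σ - σ'‖ ≤ Kall * η :=
    calc ‖σ - σ'‖ = ‖Φ m₀ g - Φ m₀ g'‖ := by rw [hσ, hσ']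
      _ ≤ ∑ j ∈ Finset.Icc (-(R : ℤ)) R, κ j * ‖g (m₀ + j) - g' (m₀ + j)‖ := hlip1 m₀ g g' hg hg'
      _ ≤ ∑ j ∈ Finset.Icc (-(R : ℤ)) R, κ j * η :=
          Finset.sum_le_sum (fun j hj => mul_le_mul_of_nonneg_left (hsmall j hj).le (hκ j))
      _ = Kall * η := by rw [← Finset.sum_mul, hKall]
  have h2 : Kall * η < ‖σ - σ'‖ := by
    rw [show Kall * η = ‖σ - σ'‖ * (Kall / (2 * (Kall + 1))) by rw [hη]; ring]
    exact mul_lt_of_lt_one_right hpos (by rw [div_lt_one (by positivity)]; linarith)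
  linarith

/-- **ABSTRACT PS «ProfileSlaving»** (windows, finite coupling range in ℓ¹ form, `Σ_{j≠0} κ j < λ`): two offset profiles `w, w'`
whose increment profiles lie in the windows and are balanced (constant transmitted stress each), and whose DIFFERENCE IS BOUNDED,
differ by a translation. -/
theorem slaving_translation {lam : ℝ} (hκ : ∀ j, 0 ≤ κ j) (hdom : ∑ j ∈ (Finset.Icc (-(R : ℤ)) R).erase 0, κ j < lam)
    (hmono : ∀ m : ℤ, ∀ h : ℤ → E, (∀ k, h k ∈ W k) → ∀ b' ∈ W m,
      lam * ‖h m - b'‖ ^ 2 ≤ ⟪Φ m h - Φ m (Function.update h m b'), h m - b'⟫)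
    (hlip1 : ∀ m : ℤ, ∀ h h' : ℤ → E, (∀ k, h k ∈ W k) → (∀ k, h' k ∈ W k) →
      ‖Φ m h - Φ m h'‖ ≤ ∑ j ∈ Finset.Icc (-(R : ℤ)) R, κ j * ‖h (m + j) - h' (m + j)‖)
    (w w' : ℤ → E) (hg : ∀ k, w k - w (k - 1) ∈ W k) (hg' : ∀ k, w' k - w' (k - 1) ∈ W k) {σ σ' : E}
    (hσ : ∀ m, Φ m (fun k => w k - w (k - 1)) = σ) (hσ' : ∀ m, Φ m (fun k => w' k - w' (k - 1)) = σ')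
    {D : ℝ} (hD : ∀ m, ‖w m - w' m‖ ≤ D) : ∃ c : E, ∀ m, w' m = w m + c := by
  have hsum : ∀ a b : ℤ, ‖∑ m ∈ Finset.Icc a b, ((w m - w (m - 1)) - (w' m - w' (m - 1)))‖ ≤ 2 * D :=
    norm_sum_Icc_increments_le hD
  have hσσ' : σ = σ' :=
    slaving_stress_eq Φ W R κ hκ hdom hmono hlip1 (fun k => w k - w (k - 1)) (fun k => w' k - w' (k - 1)) hg hg' hσ hσ' hsum
  have heq : ∀ m, Φ m (fun k => w k - w (k - 1)) = Φ m (fun k => w' k - w' (k - 1)) := fun m => by rw [hσ, hσ', hσσ']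
  have hK0 : 0 ≤ ∑ j ∈ (Finset.Icc (-(R : ℤ)) R).erase 0, κ j := Finset.sum_nonneg (fun j _ => hκ j)
  have hlip : ∀ m : ℤ, ∀ h h' : ℤ → E, (∀ k, h k ∈ W k) → (∀ k, h' k ∈ W k) → h m = h' m →
      ∀ t : ℝ, (∀ k, ‖h k - h' k‖ ≤ t) → ‖Φ m h - Φ m h'‖ ≤ (∑ j ∈ (Finset.Icc (-(R : ℤ)) R).erase 0, κ j) * t := by
    intro m h h' hh hh' hm t ht
    have h1 := hlip1 m h h' hh hh'
    rw [← Finset.sum_erase (Finset.Icc (-(R : ℤ)) R) (a := 0) (by rw [add_zero, hm, sub_self, norm_zero, mul_zero])] at h1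
    refine h1.trans ?_
    rw [Finset.sum_mul]
    exact Finset.sum_le_sum (fun j _ => mul_le_mul_of_nonneg_left (ht _) (hκ j))
  have hd : ∀ m, ‖(w m - w (m - 1)) - (w' m - w' (m - 1))‖ ≤ 2 * D := fun m => by
    have := hsum m m; rwa [Finset.Icc_self, Finset.sum_singleton] at this
  have hgg := layerChainTail_unique Φ W hK0 hdom hmono hlip (fun k => w k - w (k - 1)) (fun k => w' k - w' (k - 1))
    hg hg' hd heq
  exact exists_translation_of_increments_eq (fun m => (congrFun hgg m).symm)


end Slaving

end Summit.AtomisticToContinuum.Crystallization.Theorems.ChartedPlanarOrderLayerChainLiouvilleTail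

end
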